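import Mathlib
import HarnessLib

/-!
# Enstrophy-budget continuity: the `3/2`-power majorant and the minimal-budget lemma

Analysis/FluidPDE file, elementary (real analysis only; no PDE). It isolates the two pieces of
ORDER THEORY behind a continuity ("induction on the budget") argument for a monotone value
function `f : ℝ≥0 → [0, ∞]` of an enstrophy budget `Z` — the shape of Kenig–Merle's
minimal-critical-element scheme (Kenig–Merle 2006, §4: the critical level `E_c`, compactness or
splitting at `E_c`, rigidity) and of Lions' strict-subadditivity principle (Lions 1984, §I.2,
(S.2)) — written so that a summit route can instantiate it with
`f Z = maxEnstrophy 1 E Z T` (`MaximalEnstrophy.lean`):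

* `enstrophyMajorant C E Z = C · Z · (1 + √(E Z))`, the candidate a-priori law suggested by the
  computed maximal growth `𝓔_max(T) ∼ 𝓔₀^{3/2}` of Kang–Yun–Protas 2020 (§5, fig. 8 and eq. (5.1))
  written with the scale-invariant product `E Z` (so that `Φ(E, Z) ≍ Z` for `E Z ≪ 1` and
  `≍ E^{1/2} Z^{3/2}` for `E Z ≫ 1`); it is STRICTLY SUPERADDITIVE in `Z` with a quantified defect,
  `enstrophyMajorant_gap`: if budgets `Z_j ≤ Z - γ` and `ζ` share `Σ_j Z_j + ζ ≤ Z`, then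
  `Σ_j Φ(Z_j) + ζ + enstrophyMargin < Φ(Z)` with the explicit positive `enstrophyMargin C E Z γ`;
* `lt_top_of_budget_dichotomy`, the **minimal-budget lemma**: a monotone `f` which is below `Φ`
  for small budgets, right upper semicontinuous where finite, left lower semicontinuous, and
  which at every finite level either is "attained" (`A Z`) or "splits" (`B Z`), where attainment
  and splitting each forbid TOUCHING (`f Z = Φ Z`, splitting given `f ≤ Φ` strictly below `Z`),
  is finite and `≤ Φ` at every budget. Proof: the first touching budget `inf {f < ∞, Φ < f}` and
  the first infinite budget `inf {f = ∞}` are both contradictory.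

All statements here are proved ([folklore] order theory and algebra); the file makes no claim
about Navier–Stokes. Deliberately NOT here: the value function itself (`MaximalEnstrophy.lean`)
and any assertion that it satisfies the hypotheses (those are route statements).
-/

noncomputable section

open Set Filter Topology
open scoped ENNReal NNReal

namespace Literature.Analysis.FluidPDE

section Majorant

/-- The **`3/2`-power enstrophy majorant** `Φ_C(E, Z) = C · Z · (1 + √(E · Z))` (in `ℝ≥0`):
linear in the enstrophy budget `Z` for small scale-invariant size `E Z`, of order
`E^{1/2} Z^{3/2}` for large — the finite-time law `𝓔_max ∼ 𝓔₀^{3/2}` observed by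
Kang–Yun–Protas 2020 (§5, eq. (5.1), fig. 8), here as a candidate with a free constant `C`.
[cite: KangYunProtas2020, §5 eq. (5.1)] -/
def enstrophyMajorant (C E Z : ℝ≥0) : ℝ≥0 :=
  C * Z * (1 + NNReal.sqrt (E * Z))

/-- The majorant is monotone in the enstrophy budget. [folklore] -/
theorem enstrophyMajorant_mono (C E : ℝ≥0) : Monotone (enstrophyMajorant C E) := by
  intro Z Z' h
  unfold enstrophyMajorant
  have h' : NNReal.sqrt (E * Z) ≤ NNReal.sqrt (E * Z') := NNReal.sqrt_le_sqrt.mpr (by gcongr)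
  gcongr

/-- The majorant is monotone in the energy budget. [folklore] -/
theorem enstrophyMajorant_mono_left (C Z : ℝ≥0) : Monotone (fun E => enstrophyMajorant C E Z) := by
  intro E E' h
  simp only [enstrophyMajorant]
  have h' : NNReal.sqrt (E * Z) ≤ NNReal.sqrt (E' * Z) := NNReal.sqrt_le_sqrt.mpr (by gcongr)
  gcongr

/-- For `C ≥ 1` the majorant dominates the budget itself: `Z ≤ Φ_C(E, Z)`. [folklore] -/
theorem le_enstrophyMajorant {C : ℝ≥0} (hC : 1 ≤ C) (E Z : ℝ≥0) : Z ≤ enstrophyMajorant C E Z := by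
  unfold enstrophyMajorant
  calc Z = 1 * Z * 1 := by ring
    _ ≤ C * Z * (1 + NNReal.sqrt (E * Z)) := by gcongr; exact le_self_add

/-- The majorant is positive at positive budget (`C > 0`). [folklore] -/
theorem enstrophyMajorant_pos {C E Z : ℝ≥0} (hC : 0 < C) (hZ : 0 < Z) :
    0 < enstrophyMajorant C E Z := by
  unfold enstrophyMajorant; positivity

/-- The **superadditivity margin** `m = C · Z · (√(E Z) - √(E (Z - γ))) / 2` of the majorant at
budget `Z` when every piece has budget at most `Z - γ`. [folklore] -/
def enstrophyMargin (C E Z γ : ℝ≥0) : ℝ≥0 :=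
  C * Z * (NNReal.sqrt (E * Z) - NNReal.sqrt (E * (Z - γ))) / 2

/-- The margin is positive as soon as `C, E, Z, γ > 0`. [folklore] -/
theorem enstrophyMargin_pos {C E Z γ : ℝ≥0} (hC : 0 < C) (hE : 0 < E) (hZ : 0 < Z) (hγ : 0 < γ) :
    0 < enstrophyMargin C E Z γ := by
  unfold enstrophyMargin
  have h1 : E * (Z - γ) < E * Z := mul_lt_mul_of_pos_left (tsub_lt_self hZ hγ) hE
  have h2 : 0 < NNReal.sqrt (E * Z) - NNReal.sqrt (E * (Z - γ)) :=
    tsub_pos_of_lt (NNReal.sqrt_lt_sqrt.mpr h1)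
  positivity

/-- **Strict superadditivity with margin** (the quantified defect of the `3/2`-power law): for
`C ≥ 1` and `E, Z, γ > 0`, if finitely many budgets `Z_j ≤ Z - γ` and a remainder budget `ζ`
satisfy `Σ_j Z_j + ζ ≤ Z`, then `Σ_j Φ(Z_j) + ζ + m < Φ(Z)` with `m = enstrophyMargin C E Z γ`.
Proof: `Φ(Z_j) ≤ C Z_j (1 + s')` with `s' = √(E (Z - γ)) < s = √(E Z)`, `ζ ≤ C ζ (1 + s')`, so the
left side is at most `C Z (1 + s') + m`, while `Φ(Z) = C Z (1 + s') + 2 m`. [folklore] -/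
theorem enstrophyMajorant_gap {C E Z γ : ℝ≥0} (hC : 1 ≤ C) (hE : 0 < E) (hZ : 0 < Z) (hγ : 0 < γ)
    {J : ℕ} {Zs : Fin J → ℝ≥0} {ζ : ℝ≥0} (hgain : ∀ j, Zs j + γ ≤ Z)
    (hsum : (∑ j, Zs j) + ζ ≤ Z) :
    (∑ j, enstrophyMajorant C E (Zs j)) + ζ + enstrophyMargin C E Z γ <
      enstrophyMajorant C E Z := by
  have hC0 : 0 < C := lt_of_lt_of_le one_pos hC
  have hss' : NNReal.sqrt (E * (Z - γ)) < NNReal.sqrt (E * Z) :=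
    NNReal.sqrt_lt_sqrt.mpr (mul_lt_mul_of_pos_left (tsub_lt_self hZ hγ) hE)
  have hj : ∀ j, enstrophyMajorant C E (Zs j) ≤ C * Zs j * (1 + NNReal.sqrt (E * (Z - γ))) := by
    intro j
    unfold enstrophyMajorant
    have h1 : Zs j ≤ Z - γ := le_tsub_of_add_le_right (hgain j)
    have h2 : NNReal.sqrt (E * Zs j) ≤ NNReal.sqrt (E * (Z - γ)) :=
      NNReal.sqrt_le_sqrt.mpr (by gcongr)
    gcongr
  have hsum' : (∑ j, enstrophyMajorant C E (Zs j)) ≤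
      C * (∑ j, Zs j) * (1 + NNReal.sqrt (E * (Z - γ))) := by
    calc (∑ j, enstrophyMajorant C E (Zs j))
        ≤ ∑ j, C * Zs j * (1 + NNReal.sqrt (E * (Z - γ))) := Finset.sum_le_sum fun j _ => hj j
      _ = C * (∑ j, Zs j) * (1 + NNReal.sqrt (E * (Z - γ))) := by
          rw [Finset.mul_sum, Finset.sum_mul]
  have hζ : ζ ≤ C * ζ * (1 + NNReal.sqrt (E * (Z - γ))) := by
    calc ζ = 1 * ζ * 1 := by ring
      _ ≤ C * ζ * (1 + NNReal.sqrt (E * (Z - γ))) := by gcongr; exact le_self_add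
  have key : (∑ j, enstrophyMajorant C E (Zs j)) + ζ ≤ C * Z * (1 + NNReal.sqrt (E * (Z - γ))) := by
    calc (∑ j, enstrophyMajorant C E (Zs j)) + ζ
        ≤ C * (∑ j, Zs j) * (1 + NNReal.sqrt (E * (Z - γ))) +
            C * ζ * (1 + NNReal.sqrt (E * (Z - γ))) := add_le_add hsum' hζ
      _ = C * ((∑ j, Zs j) + ζ) * (1 + NNReal.sqrt (E * (Z - γ))) := by ring
      _ ≤ C * Z * (1 + NNReal.sqrt (E * (Z - γ))) := by gcongr
  have hΦ : enstrophyMajorant C E Z = C * Z * (1 + NNReal.sqrt (E * (Z - γ))) +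
      C * Z * (NNReal.sqrt (E * Z) - NNReal.sqrt (E * (Z - γ))) := by
    unfold enstrophyMajorant
    rw [← mul_add, add_assoc, add_tsub_cancel_of_le hss'.le]
  have hpos : 0 < C * Z * (NNReal.sqrt (E * Z) - NNReal.sqrt (E * (Z - γ))) := by
    have : 0 < NNReal.sqrt (E * Z) - NNReal.sqrt (E * (Z - γ)) := tsub_pos_of_lt hss'
    positivity
  calc (∑ j, enstrophyMajorant C E (Zs j)) + ζ + enstrophyMargin C E Z γ
      ≤ C * Z * (1 + NNReal.sqrt (E * (Z - γ))) +
          C * Z * (NNReal.sqrt (E * Z) - NNReal.sqrt (E * (Z - γ))) / 2 := add_le_add key le_rfl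
    _ < C * Z * (1 + NNReal.sqrt (E * (Z - γ))) +
          C * Z * (NNReal.sqrt (E * Z) - NNReal.sqrt (E * (Z - γ))) :=
        by gcongr; exact NNReal.half_lt_self hpos.ne'
    _ = enstrophyMajorant C E Z := hΦ.symm

/-- `enstrophyMajorant_gap` read in `ℝ≥0∞`. [folklore] -/
theorem enstrophyMajorant_gap_coe {C E Z γ : ℝ≥0} (hC : 1 ≤ C) (hE : 0 < E) (hZ : 0 < Z)
    (hγ : 0 < γ) {J : ℕ} {Zs : Fin J → ℝ≥0} {ζ : ℝ≥0} (hgain : ∀ j, Zs j + γ ≤ Z)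
    (hsum : (∑ j, Zs j) + ζ ≤ Z) :
    (∑ j, (enstrophyMajorant C E (Zs j) : ℝ≥0∞)) + (ζ : ℝ≥0∞) + (enstrophyMargin C E Z γ : ℝ≥0∞) <
      (enstrophyMajorant C E Z : ℝ≥0∞) := by
  exact_mod_cast enstrophyMajorant_gap hC hE hZ hγ hgain hsum

end Majorant

section MinimalBudget

/-- **Minimal-budget lemma** (continuity / induction on the budget; the order-theoretic shape of
Kenig–Merle 2006, §4, and of Lions 1984, §I.2). Let `f : ℝ≥0 → [0, ∞]` be monotone and
`Φ : ℝ≥0 → ℝ≥0` monotone, with: `f ≤ Φ` on `[0, z₀]` for some `z₀ > 0` (small budgets); right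
upper semicontinuity of `f` where finite; left lower semicontinuity of `f` at positive budgets;
at every positive budget with `f Z < ∞` a dichotomy `A Z ∨ B Z`; `A Z` forbids `f Z = Φ Z`; and
`B Z` forbids `f Z = Φ Z` provided `f ≤ Φ` strictly below `Z`. Then `f Z < ∞` and `f Z ≤ Φ Z`
for every `Z`. [folklore] -/
theorem lt_top_of_budget_dichotomy {f : ℝ≥0 → ℝ≥0∞} {Φ : ℝ≥0 → ℝ≥0} {A B : ℝ≥0 → Prop}
    (hf : Monotone f) (hΦ : Monotone Φ) {z₀ : ℝ≥0} (hz₀ : 0 < z₀)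
    (hsmall : ∀ Z ≤ z₀, f Z ≤ Φ Z)
    (husc : ∀ Z, f Z < ⊤ → ∀ η : ℝ≥0, 0 < η → ∃ δ : ℝ≥0, 0 < δ ∧ f (Z + δ) ≤ f Z + η)
    (hlsc : ∀ Z, 0 < Z → ∀ z < f Z, ∃ Z' < Z, z < f Z')
    (hdich : ∀ Z, 0 < Z → f Z < ⊤ → A Z ∨ B Z)
    (hA : ∀ Z, 0 < Z → f Z < ⊤ → A Z → f Z ≠ Φ Z)
    (hB : ∀ Z, 0 < Z → f Z < ⊤ → B Z → (∀ Z' < Z, f Z' ≤ Φ Z') → f Z ≠ Φ Z) :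
    ∀ Z, f Z < ⊤ ∧ f Z ≤ Φ Z := by
  classical
  -- Step A: wherever `f` is finite it lies below `Φ` (no first touching budget).
  have stepA : ∀ Z, f Z < ⊤ → f Z ≤ Φ Z := by
    by_contra hV
    push Not at hV
    set V : Set ℝ≥0 := {Z | f Z < ⊤ ∧ (Φ Z : ℝ≥0∞) < f Z} with hVdef
    have hVne : V.Nonempty := by
      obtain ⟨Z, hZ, hZ'⟩ := hV
      exact ⟨Z, hZ, hZ'⟩
    have hbdd : BddBelow V := OrderBot.bddBelow V
    have hz₀V : ∀ Z ∈ V, z₀ < Z := fun Z hZ => lt_of_not_ge fun h => absurd hZ.2 (not_lt.mpr (hsmall Z h))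
    have hZ₁ : z₀ ≤ sInf V := le_csInf hVne fun Z hZ => (hz₀V Z hZ).le
    have hZ₁pos : 0 < sInf V := hz₀.trans_le hZ₁
    obtain ⟨Zv, hZv⟩ := hVne
    have hfZ₁ : f (sInf V) < ⊤ := (hf (csInf_le hbdd hZv)).trans_lt hZv.1
    have hbelow : ∀ Z' < sInf V, f Z' ≤ Φ Z' := by
      intro Z' hZ'
      have hnot : Z' ∉ V := fun h => absurd hZ' (not_lt.mpr (csInf_le hbdd h))
      have hfin : f Z' < ⊤ := (hf hZ'.le).trans_lt hfZ₁
      simp only [hVdef, Set.mem_setOf_eq, not_and, not_lt] at hnot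
      exact hnot hfin
    have hle : f (sInf V) ≤ Φ (sInf V) := by
      by_contra h
      push Not at h
      obtain ⟨Z', hZ'lt, hZ'⟩ := hlsc (sInf V) hZ₁pos (Φ (sInf V)) h
      exact (hZ'.trans_le ((hbelow Z' hZ'lt).trans (by exact_mod_cast hΦ hZ'lt.le))).false
    have hge : (Φ (sInf V) : ℝ≥0∞) ≤ f (sInf V) := by
      by_cases hmem : sInf V ∈ V
      · exact hmem.2.le
      · refine ENNReal.le_of_forall_pos_le_add fun η hη _ => ?_
        obtain ⟨δ, hδ, hδle⟩ := husc (sInf V) hfZ₁ η hη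
        obtain ⟨Z, hZV, hZlt⟩ := exists_lt_of_csInf_lt ⟨Zv, hZv⟩ (lt_add_of_pos_right (sInf V) hδ)
        calc (Φ (sInf V) : ℝ≥0∞) ≤ Φ Z := by exact_mod_cast hΦ (csInf_le hbdd hZV)
          _ ≤ f Z := hZV.2.le
          _ ≤ f (sInf V + δ) := hf hZlt.le
          _ ≤ f (sInf V) + η := hδle
    have heq : f (sInf V) = Φ (sInf V) := le_antisymm hle hge
    rcases hdich (sInf V) hZ₁pos hfZ₁ with hAZ | hBZ
    · exact hA (sInf V) hZ₁pos hfZ₁ hAZ heq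
    · exact hB (sInf V) hZ₁pos hfZ₁ hBZ hbelow heq
  -- Step B: `f` is finite everywhere (no first infinite budget).
  have stepB : ∀ Z, f Z < ⊤ := by
    by_contra hW
    push Not at hW
    obtain ⟨Zw, hZw⟩ := hW
    set W : Set ℝ≥0 := {Z | f Z = ⊤} with hWdef
    have hWne : W.Nonempty := ⟨Zw, top_le_iff.mp hZw⟩
    have hbdd : BddBelow W := OrderBot.bddBelow W
    have hz₀W : ∀ Z ∈ W, z₀ < Z := by
      intro Z hZ
      refine lt_of_not_ge fun h => ?_
      have h' := hsmall Z h
      rw [show f Z = ⊤ from hZ, top_le_iff] at h'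
      exact ENNReal.coe_ne_top h'
    have hZs : z₀ ≤ sInf W := le_csInf hWne fun Z hZ => (hz₀W Z hZ).le
    have hZspos : 0 < sInf W := hz₀.trans_le hZs
    have hfZs : f (sInf W) < ⊤ := by
      by_contra h
      have htop : f (sInf W) = ⊤ := top_le_iff.mp (not_lt.mp h)
      obtain ⟨Z', hZ'lt, hZ'⟩ :=
        hlsc (sInf W) hZspos (Φ (sInf W)) (by rw [htop]; exact ENNReal.coe_lt_top)
      have hnotW : Z' ∉ W := fun hm => absurd hZ'lt (not_lt.mpr (csInf_le hbdd hm))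
      have hfin' : f Z' < ⊤ := lt_top_iff_ne_top.mpr hnotW
      exact (hZ'.trans_le ((stepA Z' hfin').trans (by exact_mod_cast hΦ hZ'lt.le))).false
    obtain ⟨δ, hδ, hδle⟩ := husc (sInf W) hfZs 1 one_pos
    obtain ⟨Z, hZW, hZlt⟩ := exists_lt_of_csInf_lt hWne (lt_add_of_pos_right (sInf W) hδ)
    have hfin : f Z < ⊤ :=
      (hf hZlt.le).trans_lt (hδle.trans_lt (ENNReal.add_lt_top.mpr ⟨hfZs, ENNReal.coe_lt_top⟩))
    exact hfin.ne hZW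
  exact fun Z => ⟨stepB Z, stepA Z (stepB Z)⟩

end MinimalBudget

end Literature.Analysis.FluidPDE

end
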